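import Mathlib
import Literature.NumberTheory.LFunctions.Zhang2022.AppendixBTailB3Contour
import Literature.NumberTheory.LFunctions.Zhang2022.AppendixBLemma151Circles
import HarnessLib

/-!
# Zhang (2022), Appendix B, proof of (B.3): the step `Z22:§B.u015` (second line) in the reading of
# record — the double integral is its residue value up to `O(α)`, kernel-checked

Topic `Literature/NumberTheory/LFunctions/Zhang2022` (Landau–Siegel audit tree; verdict-neutral).
Y. Zhang, *Discrete mean estimates and the Landau–Siegel zero*, arXiv:2211.02515v1 (2022)
[Zhang2022LandauSiegel] — **an unrefereed manuscript under adjudication; nothing here asserts or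
denies its Theorems 1–2.** Appendix B p. 108 (tex L5330–L5333, DAG `Z22:§B.u015`, second line):
"`(1/0.504)∫_{0.5}^{0.504}{(1/2πi)∫_{(1)}(P^{β₆(0.504−z)}P^{zs} − P^{0.004β₆}P^{0.5s}) ζ(1+s)/ζ(1+s−β_j)
ω₁(s−β₆)ds/(l₁ˢ(s−β₆))}dz = (1/0.504)(β_j/β₆)∫_{0.5}^{0.504}(P^{β₆(0.504−z)} − P^{0.004β₆})dz + O(α₁)`",
typed `Typed.AppendixB.StepB_u015bR c′` (`‖doubleB15 − valueB15‖ ≤ C·α₁`, `α₁ = α log T`).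

PROOF (`stepB_u015bR_holds`). For each `z` the inner line integral is
`c₁(z)·V(P^z/l₁) − c₂·V(P^{0.5}/l₁)` with `c₁(z) = P^{β₆(0.504−z)}`, `c₂ = P^{0.004β₆}` (both of modulus
`1`) and `V(x) = (1/2πi)∫_{(1)} xˢζ(1+s)ζ(1+s−β_j)⁻¹ω₁(s−β₆)(s−β₆)⁻¹ds`; by the contour shift of the
companion file (`AppendixBVarrho.lineIntegral_sub_residues_le`: `V(x) = R₀ + R_β(x) + O(α)` for
`e^{0.4𝓛⁹} ≤ x ≤ e^{0.504𝓛⁹}`, which holds here because `1 ≤ l₁ < T`) the residues at the kernel pole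
`s = β₆` CANCEL exactly (`c₁(z)(P^z/l₁)^{β₆} = c₂(P^{0.5}/l₁)^{β₆} = (P^{0.504}/l₁)^{β₆}`), and the
residue at `s = 0`, `R₀ = (β_j/β₆)·ω₁(−β₆)/ζ₁(1−β_j)`, is `β_j/β₆ + O(α)` (`ζ₁(1−β_j) = 1 − β_jζ₀(1−β_j)`
with Mathlib's entire `riemannZeta₀`, `ω₁(−β₆) = e^{−9α²/(16Λ)}`); integrating over `z ∈ [0.5, 0.504]`
(the integrand is continuous in `z` by dominated convergence) gives `‖doubleB15 − valueB15‖ ≤ C·α ≤ C·α₁`.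
Together with `stepB_u015aR_holds` (`AppendixBTailB3Fubini`) this feeds the tree's
`AppendixBVarrho.tailB3_sub_e1ppD_of` (the (B.3) tail at the DERIVED value `e″_{1j} = −jπi·b*`).
No claim about Lemma 15.1, Theorems 1–2 of the source or about Landau–Siegel zeros is made.

## References

* Y. Zhang, arXiv:2211.02515v1 (2022), App. B p. 108 (proof of (B.3)); §4 (4.1).
  [cite: Zhang2022LandauSiegel, App. B p.108]
-/

noncomputable section

open Complex Real MeasureTheory Set Filter Topology

namespace Literature.NumberTheory.LFunctions.Zhang2022.AppendixBVarrho

open Literature.NumberTheory.LFunctions.Zhang2022 Skeleton Typed.AppendixB GaussWeight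

/-! ## Small facts -/

/-- `log D ≥ M` once `D ≥ ⌈e^M⌉`. [folklore] -/
private theorem le_ell_of_ceil_exp_le₆ {M : ℝ} {D : ℕ} (hD : ⌈Real.exp M⌉₊ ≤ D) : M ≤ ell D := by
  have h : Real.exp M ≤ D := le_trans (Nat.le_ceil _) (by exact_mod_cast hD)
  exact (Real.le_log_iff_exp_le (lt_of_lt_of_le (Real.exp_pos _) h)).mpr h

/-- `ζ₀` (Mathlib's entire `ζ(s) − (s−1)⁻¹`) is bounded near `1`: `‖ζ₀(1+w)‖ ≤ K₀` for `‖w‖ ≤ δ₀`.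
[cite: Titchmarsh1986, §2.1 eq. (2.1.16)] -/
theorem zeta0_near_one : ∃ δ₀ : ℝ, 0 < δ₀ ∧ ∃ K₀ : ℝ, 0 ≤ K₀ ∧
    ∀ w : ℂ, ‖w‖ ≤ δ₀ → ‖riemannZeta₀ (1 + w)‖ ≤ K₀ := by
  have hc : ContinuousAt riemannZeta₀ 1 := differentiable_riemannZeta₀.continuous.continuousAt
  obtain ⟨δ, hδ, h⟩ := Metric.continuousAt_iff.mp hc 1 one_pos
  refine ⟨δ / 2, by positivity, ‖riemannZeta₀ 1‖ + 1, by positivity, fun w hw => ?_⟩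
  have hdist : dist (1 + w) 1 < δ := by
    rw [dist_eq_norm, add_sub_cancel_left]; linarith
  have h1 := h hdist
  rw [dist_eq_norm] at h1
  calc ‖riemannZeta₀ (1 + w)‖ = ‖(riemannZeta₀ (1 + w) - riemannZeta₀ 1) + riemannZeta₀ 1‖ := by ring_nf
    _ ≤ ‖riemannZeta₀ (1 + w) - riemannZeta₀ 1‖ + ‖riemannZeta₀ 1‖ := norm_add_le _ _
    _ ≤ ‖riemannZeta₀ 1‖ + 1 := by linarith

/-! ## The residue at `s = 0` is `β_j/β₆ + O(α)` -/

/-- **`R₀ = β_j/β₆ + O(α)`**: with `R₀ = (β_j/β₆)·ω₁(−β₆)/ζ₁(1−β_j)` (the residue at `s = 0` of the inner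
integrand of `Z22:§B.u015`, `Λ = 𝓛³⁰`), for `𝓛 ≥ L₁` and `j ∈ {1,2,3}`:
`‖R₀ − β_j/β₆‖ ≤ C₁·α` (`|β_j/β₆| ≤ 8/3`, `ζ₁(1−β_j) = 1 − β_jζ₀(1−β_j) = 1 + O(α)`,
`ω₁(−β₆) = e^{−9α²/(16Λ)} = 1 + O(α²)`). [cite: Zhang2022LandauSiegel, App. B p.108] -/
theorem R0_sub_le (c' : ℝ) : ∃ C₁ : ℝ, 0 ≤ C₁ ∧ ∃ L₁ : ℝ, ∀ (D : ℕ), L₁ ≤ ell D →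
    ∀ (j : ℕ), j ∈ ({1, 2, 3} : Finset ℕ) →
      ‖betaJ c' D j / beta6 D * (omega1 (ell D ^ 30) (-beta6 D) / riemannZeta₁ (1 - betaJ c' D j)) -
          betaJ c' D j / beta6 D‖ ≤ C₁ * alpha D := by
  obtain ⟨δ₀, hδ₀, K₀, hK₀, hζ₀⟩ := zeta0_near_one
  refine ⟨8 / 3 * (4 + 8 * K₀), by positivity,
    max (max 2 (60 * |c'| * π + 1)) (max (4 * π / δ₀ + 1) (32 * π * K₀ + 1)), ?_⟩
  intro D hL j hj
  set L : ℝ := ell D with hLdef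
  have hL2 : 2 ≤ L := le_trans (le_trans (le_max_left _ _) (le_max_left _ _)) hL
  have hLc : 60 * |c'| * π + 1 ≤ L := le_trans (le_trans (le_max_right _ _) (le_max_left _ _)) hL
  have hLδ : 4 * π / δ₀ + 1 ≤ L := le_trans (le_trans (le_max_left _ _) (le_max_right _ _)) hL
  have hLK : 32 * π * K₀ + 1 ≤ L := le_trans (le_trans (le_max_right _ _) (le_max_right _ _)) hL
  have hL1 : 1 ≤ L := by linarith
  have hL0 : 0 < L := by linarith
  have hαdef : alpha D = π / L ^ 9 := by rw [alpha, bigP, Real.log_exp]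
  have hα0 : 0 < alpha D := by rw [hαdef]; positivity
  have hL9 : L ≤ L ^ 9 := by
    calc L = L ^ 1 := (pow_one L).symm
      _ ≤ L ^ 9 := pow_le_pow_right₀ hL1 (by norm_num)
  have hαL : alpha D ≤ π / L := by
    rw [hαdef]; exact div_le_div_of_nonneg_left Real.pi_pos.le hL0 hL9
  -- `60|c'|α𝓛 ≤ 1`
  have hc60 : 60 * |c'| * (alpha D * ell D) ≤ 1 := by
    rw [hαdef, ← hLdef]
    have hL8 : 60 * |c'| * π + 1 ≤ L ^ 8 := by
      calc 60 * |c'| * π + 1 ≤ L := hLc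
        _ = L ^ 1 := (pow_one L).symm
        _ ≤ L ^ 8 := pow_le_pow_right₀ hL1 (by norm_num)
    have hL9' : L ^ 9 = L ^ 8 * L := by ring
    rw [show π / L ^ 9 * L = π / L ^ 8 by rw [hL9']; field_simp]
    rw [show 60 * |c'| * (π / L ^ 8) = (60 * |c'| * π) / L ^ 8 by ring,
      div_le_one (by positivity)]
    linarith
  obtain ⟨-, hβj4, -, -, -⟩ := betaJ_size c' hL2 hc60 hj
  -- `β₆`
  set β : ℂ := beta6 D with hβdef
  have hβ : β = ((3 / 2 * alpha D : ℝ) : ℂ) * I := by rw [hβdef, beta6]; push_cast; ring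
  have hβnorm : ‖β‖ = 3 / 2 * alpha D := by
    rw [hβ, norm_mul, Complex.norm_I, mul_one, Complex.norm_real, Real.norm_of_nonneg (by positivity)]
  have hβ0 : β ≠ 0 := by
    rw [← norm_pos_iff, hβnorm]; positivity
  set βj : ℂ := betaJ c' D j with hβjdef
  -- `|β_j/β₆| ≤ 8/3`
  have hratio : ‖βj / β‖ ≤ 8 / 3 := by
    rw [norm_div, hβnorm, div_le_iff₀ (by positivity)]
    calc ‖βj‖ ≤ 4 * alpha D := hβj4
      _ = 8 / 3 * (3 / 2 * alpha D) := by ring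
  -- `ζ₁(1−β_j) = 1 − β_j ζ₀(1 − β_j)`, `|ζ₁(1−β_j) − 1| ≤ 4αK₀ ≤ 1/2`
  have hβjδ : ‖-βj‖ ≤ δ₀ := by
    rw [norm_neg]
    calc ‖βj‖ ≤ 4 * alpha D := hβj4
      _ ≤ 4 * (π / L) := by gcongr
      _ ≤ δ₀ := by
          rw [show 4 * (π / L) = 4 * π / L by ring, div_le_iff₀ hL0]
          have : 4 * π / δ₀ * δ₀ = 4 * π := by field_simp
          nlinarith
  have hζ₁sub : ‖riemannZeta₁ (1 - βj) - 1‖ ≤ 4 * alpha D * K₀ := by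
    have h1 : riemannZeta₁ (1 - βj) - 1 = -βj * riemannZeta₀ (1 + -βj) := by
      rw [riemannZeta₁, ← sub_eq_add_neg]; ring
    rw [h1, norm_mul, norm_neg]
    exact mul_le_mul hβj4 (hζ₀ _ hβjδ) (norm_nonneg _) (by positivity)
  have hK₀α : 4 * alpha D * K₀ ≤ 1 / 2 := by
    calc 4 * alpha D * K₀ ≤ 4 * (π / L) * K₀ := by gcongr
      _ = (4 * π * K₀) / L := by ring
      _ ≤ 1 / 2 := by
          rw [div_le_iff₀ hL0]; nlinarith
  have hζ₁low : 1 / 2 ≤ ‖riemannZeta₁ (1 - βj)‖ := by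
    have := norm_sub_norm_le (1 : ℂ) (riemannZeta₁ (1 - βj))
    rw [norm_one, norm_sub_rev] at this
    linarith
  have hζ₁ne : riemannZeta₁ (1 - βj) ≠ 0 := by
    rw [← norm_pos_iff]; linarith
  -- `|ω₁(−β₆) − 1| ≤ 2α`
  have hαsmall : alpha D ≤ 1 / 100 := by
    rw [hαdef]
    have h512 : (512 : ℝ) ≤ L ^ 9 := by
      calc (512 : ℝ) = 2 ^ 9 := by norm_num
        _ ≤ L ^ 9 := pow_le_pow_left₀ (by norm_num) hL2 9
    rw [div_le_iff₀ (by positivity)]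
    nlinarith [Real.pi_lt_four]
  have hΛ1 : (1 : ℝ) ≤ L ^ 30 := one_le_pow₀ hL1
  have hz : ‖(-β) ^ 2 / ((4 * L ^ 30 : ℝ) : ℂ)‖ ≤ alpha D := by
    rw [norm_div, norm_pow, norm_neg, hβnorm, Complex.norm_real, Real.norm_of_nonneg (by positivity),
      div_le_iff₀ (by positivity)]
    have h1 : alpha D * alpha D ≤ alpha D * (1 / 100) := mul_le_mul_of_nonneg_left hαsmall hα0.le
    nlinarith
  have hz1 : ‖(-β) ^ 2 / ((4 * L ^ 30 : ℝ) : ℂ)‖ ≤ 1 := hz.trans (by linarith)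
  have hωsub : ‖omega1 (L ^ 30) (-β) - 1‖ ≤ 2 * alpha D := by
    rw [omega1]
    calc ‖cexp ((-β) ^ 2 / ((4 * L ^ 30 : ℝ) : ℂ)) - 1‖
        ≤ 2 * ‖(-β) ^ 2 / ((4 * L ^ 30 : ℝ) : ℂ)‖ := Complex.norm_exp_sub_one_le hz1
      _ ≤ 2 * alpha D := by linarith
  -- assemble
  set ω : ℂ := omega1 (L ^ 30) (-β) with hωdef
  set Z : ℂ := riemannZeta₁ (1 - βj) with hZdef
  have hkey : βj / β * (ω / Z) - βj / β = βj / β * (((ω - 1) - (Z - 1)) / Z) := by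
    field_simp; ring
  rw [hkey, norm_mul]
  have hfrac : ‖((ω - 1) - (Z - 1)) / Z‖ ≤ (4 + 8 * K₀) * alpha D := by
    rw [norm_div]
    have hnum : ‖(ω - 1) - (Z - 1)‖ ≤ 2 * alpha D + 4 * alpha D * K₀ :=
      (norm_sub_le _ _).trans (add_le_add hωsub hζ₁sub)
    rw [div_le_iff₀ (by linarith)]
    calc ‖(ω - 1) - (Z - 1)‖ ≤ 2 * alpha D + 4 * alpha D * K₀ := hnum
      _ = (4 + 8 * K₀) * alpha D * (1 / 2) := by ring
      _ ≤ (4 + 8 * K₀) * alpha D * ‖Z‖ := by gcongr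
  calc ‖βj / β‖ * ‖((ω - 1) - (Z - 1)) / Z‖ ≤ (8 / 3) * ((4 + 8 * K₀) * alpha D) :=
        mul_le_mul hratio hfrac (norm_nonneg _) (by norm_num)
    _ = 8 / 3 * (4 + 8 * K₀) * alpha D := by ring

/-! ## The line integrand `G_x`, its integrability and its `x`-dependence -/

/-- `P^{(a·β)} = (P^a)^β` for a real `a` and `P > 0`. [folklore] -/
private theorem cpow_ofReal_mul'' {P : ℝ} (hP : 0 < P) (a : ℝ) (β : ℂ) :
    (P : ℂ) ^ ((a : ℂ) * β) = ((P ^ a : ℝ) : ℂ) ^ β := by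
  rw [Complex.ofReal_cpow hP.le, Complex.cpow_mul]
  · rw [← Complex.ofReal_log hP.le, ← Complex.ofReal_mul, Complex.ofReal_im]
    exact neg_lt_zero.mpr Real.pi_pos
  · rw [← Complex.ofReal_log hP.le, ← Complex.ofReal_mul, Complex.ofReal_im]
    exact Real.pi_pos.le

/-- **Integrability of the inner integrand on the line `Re s = 1`**: for `x > 0` and `D ≥ 3`,
`t ↦ Φ_x(1+it)K_x(1+it)` with `Φ_x(s) = x^{β₆}ζ(1+s)(s−β_j)/ζ₁(1+s−β_j)`,
`K_x(s) = x^{s−β₆}ω₁(s−β₆)/(s−β₆)` is integrable (`|Φ_x| ≤ 4` on the line, Gaussian kernel;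
`GaussKernelContour.integrable_integrand_line`). [cite: Zhang2022LandauSiegel, App. B p.108] -/
theorem integrable_G (c' : ℝ) {D : ℕ} (hD : 3 ≤ D) (j : ℕ) {x : ℝ} (hx : 0 < x) :
    Integrable fun t : ℝ =>
      ((x : ℂ) ^ beta6 D * riemannZeta (1 + (((1 : ℝ) : ℂ) + t * I)) *
          (((((1 : ℝ) : ℂ) + t * I) - betaJ c' D j) /
            riemannZeta₁ (1 + (((1 : ℝ) : ℂ) + t * I) - betaJ c' D j))) *
        ((x : ℂ) ^ ((((1 : ℝ) : ℂ) + t * I) + -beta6 D) *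
          omega1 (ell D ^ 30) ((((1 : ℝ) : ℂ) + t * I) + -beta6 D) /
          ((((1 : ℝ) : ℂ) + t * I) + -beta6 D)) := by
  have hℓ : 0 < ell D := by linarith [one_lt_ell hD]
  have hΛ : 0 < ell D ^ 30 := pow_pos hℓ 30
  set β : ℂ := beta6 D with hβdef
  set βj : ℂ := betaJ c' D j with hβjdef
  have hβre : (-β).re = 0 := by rw [hβdef, beta6]; simp
  have hβjre : βj.re = 0 := by rw [hβjdef]; exact betaJ_re c' D j
  obtain ⟨Φ, hΦdef⟩ : ∃ Φ : ℂ → ℂ, Φ = fun z => (x : ℂ) ^ β * riemannZeta (1 + z) *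
    ((z - βj) / riemannZeta₁ (1 + z - βj)) := ⟨_, rfl⟩
  have hxβ : ‖(x : ℂ) ^ β‖ = 1 := by
    rw [Complex.norm_cpow_eq_rpow_re_of_pos hx, hβdef, beta6]; simp
  -- on the line: differentiability, continuity, the bound `4`
  have hline_ne : ∀ t : ℝ, (((1 : ℝ) : ℂ) + t * I) ≠ βj := by
    intro t h; have := congrArg Complex.re h; simp [hβjre] at this
  have hζ₁line : ∀ t : ℝ, riemannZeta₁ (1 + (((1 : ℝ) : ℂ) + t * I) - βj) ≠ 0 := by
    intro t
    refine riemannZeta₁_ne_zero_of fun _ => riemannZeta_ne_zero_of_one_le_re ?_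
    simp [hβjre]
  have hΦdiff : ∀ t : ℝ, DifferentiableAt ℂ Φ (((1 : ℝ) : ℂ) + t * I) := by
    intro t
    set z : ℂ := (((1 : ℝ) : ℂ) + t * I) with hz
    have hz0 : z ≠ 0 := by intro h; have := congrArg Complex.re h; simp [hz] at this
    have h1 : DifferentiableAt ℂ (fun z : ℂ => riemannZeta (1 + z)) z := by
      have h := differentiableAt_riemannZeta (s := 1 + z) (by intro h; apply hz0; linear_combination h)
      exact h.comp z (by fun_prop)
    have h2 : DifferentiableAt ℂ (fun z : ℂ => riemannZeta₁ (1 + z - βj)) z :=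
      (differentiable_riemannZeta₁.differentiableAt).comp z
        ((differentiableAt_id.const_add (1 : ℂ)).sub_const βj)
    have h3 : DifferentiableAt ℂ (fun z : ℂ => (z - βj) / riemannZeta₁ (1 + z - βj)) z :=
      (differentiableAt_id.sub_const βj).div h2 (hζ₁line t)
    rw [hΦdef]
    exact ((differentiableAt_const _).mul h1).mul h3
  have hΦcont : Continuous fun t : ℝ => Φ (((1 : ℝ) : ℂ) + t * I) := by
    have hl : Continuous fun t : ℝ => (((1 : ℝ) : ℂ) + t * I) := by fun_prop
    refine continuous_iff_continuousAt.mpr fun t => ?_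
    exact ContinuousAt.comp (g := Φ) (f := fun t : ℝ => (((1 : ℝ) : ℂ) + t * I))
      (hΦdiff t).continuousAt hl.continuousAt
  have hΦ₀ : ∀ t : ℝ, ‖Φ (((1 : ℝ) : ℂ) + t * I)‖ ≤ 4 := by
    intro t
    have hw : 1 + (((1 : ℝ) : ℂ) + t * I) - βj ≠ 1 := by
      intro h; apply hline_ne t; linear_combination h
    have hΦ_eq : Φ (((1 : ℝ) : ℂ) + t * I) = (x : ℂ) ^ β * riemannZeta (1 + (((1 : ℝ) : ℂ) + t * I)) *
        (riemannZeta (1 + (((1 : ℝ) : ℂ) + t * I) - βj))⁻¹ := by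
      rw [hΦdef]; dsimp only
      rw [inv_riemannZeta_eq_div_zeta₁ hw]
      congr 2
      ring
    rw [hΦ_eq, norm_mul, norm_mul, hxβ, one_mul]
    have hre1 : (1 + (((1 : ℝ) : ℂ) + t * I)).re = 2 := by simp; norm_num
    have hre2 : (1 + (((1 : ℝ) : ℂ) + t * I) - βj).re = 2 := by simp [hβjre]; norm_num
    have b1 := (norm_zeta_and_inv_le_two hre1).1
    have b2 := (norm_zeta_and_inv_le_two hre2).2
    calc ‖riemannZeta (1 + (((1 : ℝ) : ℂ) + t * I))‖ * ‖(riemannZeta (1 + (((1 : ℝ) : ℂ) + t * I) - βj))⁻¹‖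
        ≤ 2 * 2 := mul_le_mul b1 b2 (norm_nonneg _) (by norm_num)
      _ = 4 := by norm_num
  have hσ₀ : (1 : ℝ) + (-β).re ≠ 0 := by rw [hβre]; norm_num
  have h := GaussKernelContour.integrable_integrand_line (Φ := Φ) (β := -β) hΛ hx (σ := 1) hσ₀ hΦcont hΦ₀
  rw [hΦdef] at h
  exact h

/-- **The `x`-dependence of the integrand**: `Φ_x(s)K_x(s) = xˢ · Φ₁(s)K₁(s)` (`x^{β₆}·x^{s−β₆} = xˢ`,
`1^w = 1`). [cite: Zhang2022LandauSiegel, App. B p.108] -/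
theorem G_eq_cpow_mul (c' : ℝ) (D j : ℕ) {x : ℝ} (hx : 0 < x) (s : ℂ) :
    ((x : ℂ) ^ beta6 D * riemannZeta (1 + s) * ((s - betaJ c' D j) / riemannZeta₁ (1 + s - betaJ c' D j))) *
        ((x : ℂ) ^ (s + -beta6 D) * omega1 (ell D ^ 30) (s + -beta6 D) / (s + -beta6 D)) =
      (x : ℂ) ^ s *
        (((1 : ℂ) ^ beta6 D * riemannZeta (1 + s) * ((s - betaJ c' D j) / riemannZeta₁ (1 + s - betaJ c' D j))) *
          ((1 : ℂ) ^ (s + -beta6 D) * omega1 (ell D ^ 30) (s + -beta6 D) / (s + -beta6 D))) := by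
  have hxC : (x : ℂ) ≠ 0 := by exact_mod_cast hx.ne'
  have hpow : (x : ℂ) ^ beta6 D * (x : ℂ) ^ (s + -beta6 D) = (x : ℂ) ^ s := by
    rw [← Complex.cpow_add _ _ hxC]; congr 1; ring
  rw [Complex.one_cpow, Complex.one_cpow]
  calc ((x : ℂ) ^ beta6 D * riemannZeta (1 + s) * ((s - betaJ c' D j) / riemannZeta₁ (1 + s - betaJ c' D j))) *
        ((x : ℂ) ^ (s + -beta6 D) * omega1 (ell D ^ 30) (s + -beta6 D) / (s + -beta6 D))
      = ((x : ℂ) ^ beta6 D * (x : ℂ) ^ (s + -beta6 D)) *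
          (riemannZeta (1 + s) * ((s - betaJ c' D j) / riemannZeta₁ (1 + s - betaJ c' D j)) *
            (omega1 (ell D ^ 30) (s + -beta6 D) / (s + -beta6 D))) := by ring
    _ = _ := by rw [hpow]; ring

/-! ## `Z22:§B.u015` (second line) in the reading of record -/

set_option maxHeartbeats 1600000 in -- one long assembly (pointwise identity, cancellation, dominated continuity, z-integral)
/-- **`Z22:§B.u015`, second line, HOLDS in the reading of record `α₁ = α log T`**
(`Typed.AppendixB.StepB_u015bR c′`: `‖doubleB15 − valueB15‖ ≤ C·α₁` for all large `D`, `j ∈ {1,2,3}`,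
`1 ≤ l₁ ∈ 𝒩(𝔮)`, `l₁ < T`). Original: "`= (1/0.504)(β_j/β₆)∫_{0.5}^{0.504}(P^{β₆(0.504−z)} − P^{0.004β₆})dz
+ O(α₁)`" (App. B p.108, tex L5333). The inner line integral is `c₁(z)V(P^z/l₁) − c₂V(P^{0.5}/l₁)`, each
`V` is its two residues up to `C₀α` (`lineIntegral_sub_residues_le`), the residues at `β₆` cancel, the
residue at `0` is `β_j/β₆ + O(α)` (`R0_sub_le`), and the `z`-integral has length `0.004`.
[cite: Zhang2022LandauSiegel, App. B p.108] -/
theorem stepB_u015bR_holds (c' : ℝ) : StepB_u015bR c' := by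
  obtain ⟨C₀, hC₀, L₀, hV⟩ := lineIntegral_sub_residues_le c'
  obtain ⟨C₁, hC₁, L₁, hR⟩ := R0_sub_le c'
  set Lm : ℝ := max (max L₀ L₁) 2 with hLm
  refine ⟨(1 / 0.504) * ((2 * C₀ + 2 * C₁) * 0.004), max ⌈Real.exp Lm⌉₊ 3, ?_⟩
  intro D _ χ hD _ _ j hj l₁ hl₁ _ hT
  -- ### parameters
  have hD3 : 3 ≤ D := le_trans (le_max_right _ _) hD
  have hLm_le : Lm ≤ ell D := le_ell_of_ceil_exp_le₆ (le_trans (le_max_left _ _) hD)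
  set L : ℝ := ell D with hLdef
  have hL₀ : L₀ ≤ L := le_trans (le_trans (le_max_left _ _) (le_max_left _ _)) hLm_le
  have hL₁ : L₁ ≤ L := le_trans (le_trans (le_max_right _ _) (le_max_left _ _)) hLm_le
  have hL2 : 2 ≤ L := le_trans (le_max_right _ _) hLm_le
  have hL1 : 1 ≤ L := by linarith
  have hL0 : 0 < L := by linarith
  have hαdef : alpha D = π / L ^ 9 := by rw [alpha, bigP, Real.log_exp]
  have hα0 : 0 < alpha D := by rw [hαdef]; positivity
  set P : ℝ := bigP D with hPdef
  have hPexp : P = Real.exp (L ^ 9) := by rw [hPdef, bigP]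
  have hP0 : 0 < P := by rw [hPexp]; exact Real.exp_pos _
  have hP1 : 1 ≤ P := by rw [hPexp]; exact Real.one_le_exp (by positivity)
  have hPC : (P : ℂ) ≠ 0 := by exact_mod_cast hP0.ne'
  have hl₁0 : (0 : ℝ) < l₁ := by exact_mod_cast hl₁
  have hl₁1 : (1 : ℝ) ≤ l₁ := by exact_mod_cast hl₁
  set Λ : ℝ := L ^ 30 with hΛdef
  set β : ℂ := beta6 D with hβdef
  set βj : ℂ := betaJ c' D j with hβjdef
  have hβ : β = ((3 / 2 * alpha D : ℝ) : ℂ) * I := by rw [hβdef, beta6]; push_cast; ring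
  have hβ0 : β ≠ 0 := by
    rw [hβ]; intro h
    have := congrArg Complex.im h; simp at this; linarith
  have hβjre : βj.re = 0 := by rw [hβjdef]; exact betaJ_re c' D j
  -- `P^z` as an exponential, and the range of `x = P^z/l₁`
  have hPz : ∀ z : ℝ, P ^ z = Real.exp (z * L ^ 9) := by
    intro z; rw [hPexp, ← Real.exp_mul, mul_comm]
  have hxpos : ∀ z : ℝ, 0 < P ^ z / l₁ := fun z => div_pos (Real.rpow_pos_of_pos hP0 z) hl₁0
  have hT : (l₁ : ℝ) < Real.exp (L ^ (1.1 : ℝ)) := by rw [hLdef]; exact hT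
  have hL11 : L ^ (1.1 : ℝ) ≤ 0.1 * L ^ 9 := by
    have h1 : L ^ (1.1 : ℝ) ≤ L ^ (2 : ℝ) := Real.rpow_le_rpow_of_exponent_le hL1 (by norm_num)
    have h2 : L ^ (2 : ℝ) = L ^ 2 := by norm_cast
    have h3 : (2 : ℝ) ^ 7 ≤ L ^ 7 := pow_le_pow_left₀ (by norm_num) hL2 7
    have h4 : L ^ 9 = L ^ 2 * L ^ 7 := by ring
    rw [h2] at h1
    nlinarith [pow_pos hL0 2]
  have hxlow : ∀ z : ℝ, 0.5 ≤ z → Real.exp (0.4 * L ^ 9) ≤ P ^ z / l₁ := by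
    intro z hz
    rw [le_div_iff₀ hl₁0, hPz]
    calc Real.exp (0.4 * L ^ 9) * l₁ ≤ Real.exp (0.4 * L ^ 9) * Real.exp (L ^ (1.1 : ℝ)) := by
          gcongr
      _ = Real.exp (0.4 * L ^ 9 + L ^ (1.1 : ℝ)) := by rw [Real.exp_add]
      _ ≤ Real.exp (z * L ^ 9) := Real.exp_le_exp.mpr (by nlinarith [pow_pos hL0 9])
  have hxup : ∀ z : ℝ, z ≤ 0.504 → P ^ z / l₁ ≤ Real.exp (0.504 * L ^ 9) := by
    intro z hz
    calc P ^ z / l₁ ≤ P ^ z := div_le_self (Real.rpow_pos_of_pos hP0 z).le hl₁1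
      _ = Real.exp (z * L ^ 9) := hPz z
      _ ≤ Real.exp (0.504 * L ^ 9) := Real.exp_le_exp.mpr (by nlinarith [pow_pos hL0 9])
  -- ### the objects
  obtain ⟨G, hGdef⟩ : ∃ G : ℝ → ℝ → ℂ, G = fun (x : ℝ) (t : ℝ) =>
      ((x : ℂ) ^ β * riemannZeta (1 + (((1 : ℝ) : ℂ) + t * I)) *
          (((((1 : ℝ) : ℂ) + t * I) - βj) / riemannZeta₁ (1 + (((1 : ℝ) : ℂ) + t * I) - βj))) *
        ((x : ℂ) ^ ((((1 : ℝ) : ℂ) + t * I) + -β) * omega1 Λ ((((1 : ℝ) : ℂ) + t * I) + -β) /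
          ((((1 : ℝ) : ℂ) + t * I) + -β)) := ⟨_, rfl⟩
  obtain ⟨V, hVdef⟩ : ∃ V : ℝ → ℂ, V = fun x => (1 / (2 * π) : ℂ) * ∫ t : ℝ, G x t := ⟨_, rfl⟩
  set R₀ : ℂ := βj / β * (omega1 Λ (-β) / riemannZeta₁ (1 - βj)) with hR₀
  obtain ⟨Rβ, hRβdef⟩ : ∃ Rβ : ℝ → ℂ, Rβ = fun (x : ℝ) =>
      (x : ℂ) ^ β * riemannZeta (1 + β) * ((β - βj) / riemannZeta₁ (1 + β - βj)) := ⟨_, rfl⟩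
  obtain ⟨c₁, hc₁def⟩ : ∃ c₁ : ℝ → ℂ, c₁ = fun z => (P : ℂ) ^ (β * ((0.504 - z : ℝ) : ℂ)) := ⟨_, rfl⟩
  set c₂ : ℂ := (P : ℂ) ^ (((0.004 : ℝ) : ℂ) * β) with hc₂
  -- the contour estimate and the residue estimate, instantiated
  have hVest : ∀ x : ℝ, Real.exp (0.4 * L ^ 9) ≤ x → x ≤ Real.exp (0.504 * L ^ 9) →
      ‖V x - (R₀ + Rβ x)‖ ≤ C₀ * alpha D := by
    intro x hx1 hx2
    have h := hV D (by rw [← hLdef]; exact hL₀) j hj x (by rw [← hLdef]; exact hx1)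
      (by rw [← hLdef]; exact hx2)
    rw [hVdef, hRβdef, hGdef]
    exact h
  have hRest : ‖R₀ - βj / β‖ ≤ C₁ * alpha D := by
    have h := hR D (by rw [← hLdef]; exact hL₁) j hj
    rw [hR₀]
    exact h
  -- norms of `c₁ z`, `c₂`
  have hnormc₁ : ∀ z : ℝ, ‖c₁ z‖ = 1 := by
    intro z
    rw [hc₁def]; dsimp only
    rw [Complex.norm_cpow_eq_rpow_re_of_pos hP0, hβ]
    simp
  have hnormc₂ : ‖c₂‖ = 1 := by
    rw [hc₂, Complex.norm_cpow_eq_rpow_re_of_pos hP0, hβ]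
    simp
  -- ### the cancellation of the residues at `β₆`
  have hcollect : ∀ (c₀ cz : ℝ), c₀ + cz = 0.504 →
      (P : ℂ) ^ (β * (c₀ : ℂ)) * ((P ^ cz / l₁ : ℝ) : ℂ) ^ β = ((P ^ (0.504 : ℝ) / l₁ : ℝ) : ℂ) ^ β := by
    intro c₀ cz hc
    have hPcz : 0 < P ^ cz := Real.rpow_pos_of_pos hP0 cz
    have hP5 : 0 < P ^ (0.504 : ℝ) := Real.rpow_pos_of_pos hP0 _
    rw [GaussWeight.div_cpow_line hPcz hl₁0, GaussWeight.div_cpow_line hP5 hl₁0,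
      ← cpow_ofReal_mul'' hP0 cz β, ← cpow_ofReal_mul'' hP0 0.504 β, mul_div_assoc',
      ← Complex.cpow_add _ _ hPC]
    congr 2
    rw [← hc]; push_cast; ring
  have hcancel : ∀ z : ℝ, c₁ z * Rβ (P ^ z / l₁) = c₂ * Rβ (P ^ (0.5 : ℝ) / l₁) := by
    intro z
    have h1 : c₁ z * (((P ^ z / l₁ : ℝ) : ℂ)) ^ β = ((P ^ (0.504 : ℝ) / l₁ : ℝ) : ℂ) ^ β := by
      rw [hc₁def]; exact hcollect (0.504 - z) z (by ring)
    have h2 : c₂ * (((P ^ (0.5 : ℝ) / l₁ : ℝ) : ℂ)) ^ β = ((P ^ (0.504 : ℝ) / l₁ : ℝ) : ℂ) ^ β := by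
      rw [hc₂, mul_comm (((0.004 : ℝ) : ℂ)) β]; exact hcollect 0.004 0.5 (by norm_num)
    rw [hRβdef]; dsimp only
    calc c₁ z * ((((P ^ z / l₁ : ℝ) : ℂ)) ^ β * riemannZeta (1 + β) * ((β - βj) / riemannZeta₁ (1 + β - βj)))
        = (c₁ z * (((P ^ z / l₁ : ℝ) : ℂ)) ^ β) * (riemannZeta (1 + β) * ((β - βj) / riemannZeta₁ (1 + β - βj))) := by
          ring
      _ = (c₂ * (((P ^ (0.5 : ℝ) / l₁ : ℝ) : ℂ)) ^ β) *
            (riemannZeta (1 + β) * ((β - βj) / riemannZeta₁ (1 + β - βj))) := by rw [h1, h2]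
      _ = _ := by ring
  -- ### the pointwise identity on the line `Re s = 1`
  have hline_ne : ∀ t : ℝ, (((1 : ℝ) : ℂ) + t * I) ≠ βj := by
    intro t h; have := congrArg Complex.re h; simp [hβjre] at this
  have hpt : ∀ (z : ℝ) (t : ℝ),
      mellinB14 D z (((1 : ℝ) : ℂ) + t * I) * zetaRatio c' D j (((1 : ℝ) : ℂ) + t * I) *
          omega1 (ell D ^ 30) ((((1 : ℝ) : ℂ) + t * I) - beta6 D) /
        ((l₁ : ℂ) ^ (((1 : ℝ) : ℂ) + t * I) * ((((1 : ℝ) : ℂ) + t * I) - beta6 D)) =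
      c₁ z * G (P ^ z / l₁) t - c₂ * G (P ^ (0.5 : ℝ) / l₁) t := by
    intro z t
    set s : ℂ := (((1 : ℝ) : ℂ) + t * I) with hs
    have hsβ : s + -β ≠ 0 := by
      rw [← sub_eq_add_neg]; intro h
      have := congrArg Complex.re h; simp [hs, hβ] at this
    have hl₁C : (l₁ : ℂ) ≠ 0 := by exact_mod_cast (show (l₁ : ℕ) ≠ 0 by omega)
    have hl₁s : (l₁ : ℂ) ^ s ≠ 0 := by
      rw [Ne, Complex.cpow_eq_zero_iff]; exact fun h => hl₁C h.1
    -- `mellinB14`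
    have e1 : mellinB14 D z s = c₁ z * ((P ^ z : ℝ) : ℂ) ^ s - c₂ * ((P ^ (0.5 : ℝ) : ℝ) : ℂ) ^ s := by
      rw [mellinB14, hc₁def, hc₂, ← hPdef, ← hβdef, cpow_ofReal_mul'' hP0 z s,
        cpow_ofReal_mul'' hP0 0.5 s]
    -- `zetaRatio`
    have e2 : zetaRatio c' D j s = riemannZeta (1 + s) * ((s - βj) / riemannZeta₁ (1 + s - βj)) := by
      have hw : 1 + s - βj ≠ 1 := by intro h; apply hline_ne t; rw [← hs]; linear_combination h
      rw [zetaRatio, ← hβjdef, div_eq_mul_inv, inv_riemannZeta_eq_div_zeta₁ hw]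
      congr 2; ring
    -- `G x t = x^s · (…)`
    have e3 : ∀ x : ℝ, 0 < x → G x t = ((x : ℝ) : ℂ) ^ s *
        (riemannZeta (1 + s) * ((s - βj) / riemannZeta₁ (1 + s - βj)) *
          (omega1 Λ (s + -β) / (s + -β))) := by
      intro x hx
      have hxC : (x : ℂ) ≠ 0 := by exact_mod_cast hx.ne'
      have hpow : (x : ℂ) ^ β * (x : ℂ) ^ (s + -β) = (x : ℂ) ^ s := by
        rw [← Complex.cpow_add _ _ hxC]; congr 1; ring
      rw [hGdef]; dsimp only
      rw [← hs]
      calc ((x : ℂ) ^ β * riemannZeta (1 + s) * ((s - βj) / riemannZeta₁ (1 + s - βj))) *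
          ((x : ℂ) ^ (s + -β) * omega1 Λ (s + -β) / (s + -β))
          = ((x : ℂ) ^ β * (x : ℂ) ^ (s + -β)) * (riemannZeta (1 + s) *
              ((s - βj) / riemannZeta₁ (1 + s - βj)) * (omega1 Λ (s + -β) / (s + -β))) := by ring
        _ = _ := by rw [hpow]
    have e4 : ∀ c : ℝ, (((P ^ c / l₁ : ℝ) : ℂ)) ^ s = ((P ^ c : ℝ) : ℂ) ^ s / (l₁ : ℂ) ^ s := by
      intro c
      rw [GaussWeight.div_cpow_line (Real.rpow_pos_of_pos hP0 c) hl₁0, Complex.ofReal_natCast]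
    rw [e3 _ (hxpos z), e3 _ (hxpos 0.5), e4, e4, e1, e2, ← hβdef, sub_eq_add_neg s β]
    field_simp
    ring
  -- ### integrability of `G x ·` and the value of the inner integral
  have hGint : ∀ x : ℝ, 0 < x → Integrable (G x) := by
    intro x hx
    have h := integrable_G c' hD3 j hx
    rw [hGdef]
    exact h
  have hinner : ∀ z : ℝ, vline 1 (fun s => mellinB14 D z s * zetaRatio c' D j s *
      omega1 (ell D ^ 30) (s - beta6 D) / ((l₁ : ℂ) ^ s * (s - beta6 D))) =
      c₁ z * V (P ^ z / l₁) - c₂ * V (P ^ (0.5 : ℝ) / l₁) := by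
    intro z
    rw [vline]
    have hfun : (fun t : ℝ => mellinB14 D z (((1 : ℝ) : ℂ) + (t : ℂ) * I) *
        zetaRatio c' D j (((1 : ℝ) : ℂ) + (t : ℂ) * I) *
          omega1 (ell D ^ 30) ((((1 : ℝ) : ℂ) + (t : ℂ) * I) - beta6 D) /
        ((l₁ : ℂ) ^ (((1 : ℝ) : ℂ) + (t : ℂ) * I) * ((((1 : ℝ) : ℂ) + (t : ℂ) * I) - beta6 D))) =
        fun t : ℝ => c₁ z * G (P ^ z / l₁) t - c₂ * G (P ^ (0.5 : ℝ) / l₁) t := funext (hpt z)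
    rw [hfun, MeasureTheory.integral_sub ((hGint _ (hxpos z)).const_mul _)
      ((hGint _ (hxpos 0.5)).const_mul _), MeasureTheory.integral_const_mul,
      MeasureTheory.integral_const_mul, hVdef]
    ring
  -- ### the pointwise bound in `z`
  have hE : ∀ z : ℝ, 0.5 ≤ z → z ≤ 0.504 →
      ‖(c₁ z * V (P ^ z / l₁) - c₂ * V (P ^ (0.5 : ℝ) / l₁)) - βj / β * (c₁ z - c₂)‖ ≤
        (2 * C₀ + 2 * C₁) * alpha D := by
    intro z hz1 hz2
    set x₁ : ℝ := P ^ z / l₁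
    set x₂ : ℝ := P ^ (0.5 : ℝ) / l₁
    have hV₁ := hVest x₁ (hxlow z hz1) (hxup z hz2)
    have hV₂ := hVest x₂ (hxlow 0.5 le_rfl) (hxup 0.5 (by norm_num))
    have hcan := hcancel z
    have hkey : (c₁ z * V x₁ - c₂ * V x₂) - βj / β * (c₁ z - c₂) =
        c₁ z * (V x₁ - (R₀ + Rβ x₁)) - c₂ * (V x₂ - (R₀ + Rβ x₂)) +
          (c₁ z * Rβ x₁ - c₂ * Rβ x₂) + (c₁ z - c₂) * (R₀ - βj / β) := by ring
    rw [hkey, hcan, sub_self, add_zero]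
    calc ‖c₁ z * (V x₁ - (R₀ + Rβ x₁)) - c₂ * (V x₂ - (R₀ + Rβ x₂)) + (c₁ z - c₂) * (R₀ - βj / β)‖
        ≤ ‖c₁ z * (V x₁ - (R₀ + Rβ x₁)) - c₂ * (V x₂ - (R₀ + Rβ x₂))‖ +
            ‖(c₁ z - c₂) * (R₀ - βj / β)‖ := norm_add_le _ _
      _ ≤ ‖c₁ z * (V x₁ - (R₀ + Rβ x₁))‖ + ‖c₂ * (V x₂ - (R₀ + Rβ x₂))‖ +
            ‖(c₁ z - c₂) * (R₀ - βj / β)‖ := by gcongr; exact norm_sub_le _ _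
      _ ≤ 1 * (C₀ * alpha D) + 1 * (C₀ * alpha D) + 2 * (C₁ * alpha D) := by
          rw [norm_mul, norm_mul, norm_mul, hnormc₁, hnormc₂]
          gcongr
          calc ‖c₁ z - c₂‖ ≤ ‖c₁ z‖ + ‖c₂‖ := norm_sub_le _ _
            _ = 2 := by rw [hnormc₁, hnormc₂]; norm_num
      _ = (2 * C₀ + 2 * C₁) * alpha D := by ring
  -- ### continuity in `z` of the inner integral
  have hGx : ∀ x : ℝ, 0 < x → ∀ t : ℝ,
      G x t = ((x : ℝ) : ℂ) ^ ((((1 : ℝ) : ℂ) + t * I)) * G 1 t := by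
    intro x hx t
    have hxC : (x : ℂ) ≠ 0 := by exact_mod_cast hx.ne'
    set s : ℂ := (((1 : ℝ) : ℂ) + t * I) with hs
    have hpow : (x : ℂ) ^ β * (x : ℂ) ^ (s + -β) = (x : ℂ) ^ s := by
      rw [← Complex.cpow_add _ _ hxC]; congr 1; ring
    rw [hGdef]; dsimp only
    rw [← hs]
    push_cast
    rw [Complex.one_cpow, Complex.one_cpow]
    calc ((x : ℂ) ^ β * riemannZeta (1 + s) * ((s - βj) / riemannZeta₁ (1 + s - βj))) *
        ((x : ℂ) ^ (s + -β) * omega1 Λ (s + -β) / (s + -β))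
        = ((x : ℂ) ^ β * (x : ℂ) ^ (s + -β)) * (riemannZeta (1 + s) *
            ((s - βj) / riemannZeta₁ (1 + s - βj)) * (omega1 Λ (s + -β) / (s + -β))) := by ring
      _ = _ := by rw [hpow]; ring
  have hG1 : Integrable (G 1) := hGint 1 one_pos
  have hVcont : ∀ a b : ℝ, 0 < a → ContinuousOn V (Icc a b) := by
    intro a b ha
    rw [hVdef]
    refine ContinuousOn.mul continuousOn_const ?_
    refine MeasureTheory.continuousOn_of_dominated (F := fun x t => G x t)
      (bound := fun t => b * ‖G 1 t‖) ?_ ?_ ?_ ?_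
    · intro x hx; exact (hGint x (lt_of_lt_of_le ha hx.1)).aestronglyMeasurable
    · intro x hx
      refine ae_of_all _ fun t => ?_
      have hx0 : 0 < x := lt_of_lt_of_le ha hx.1
      rw [hGx x hx0 t, norm_mul, Complex.norm_cpow_eq_rpow_re_of_pos hx0]
      have hre : ((((1 : ℝ) : ℂ) + t * I)).re = 1 := by simp
      rw [hre, Real.rpow_one]
      exact mul_le_mul_of_nonneg_right hx.2 (norm_nonneg _)
    · exact hG1.norm.const_mul b
    · refine ae_of_all _ fun t => ?_
      have heq : EqOn (fun x : ℝ => G x t)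
          (fun x : ℝ => ((x : ℝ) : ℂ) ^ ((((1 : ℝ) : ℂ) + t * I)) * G 1 t) (Icc a b) :=
        fun x hx => hGx x (lt_of_lt_of_le ha hx.1) t
      refine ContinuousOn.congr ?_ heq
      refine ContinuousOn.mul ?_ continuousOn_const
      intro x hx
      exact (Complex.continuousAt_ofReal_cpow_const x _
        (Or.inr (lt_of_lt_of_le ha hx.1).ne')).continuousWithinAt
  have hle : (0.5 : ℝ) ≤ 0.504 := by norm_num
  obtain ⟨innerF, hinnerF⟩ : ∃ innerF : ℝ → ℂ, innerF = fun z =>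
      c₁ z * V (P ^ z / l₁) - c₂ * V (P ^ (0.5 : ℝ) / l₁) := ⟨_, rfl⟩
  have hx₁cont : Continuous fun z : ℝ => P ^ z / l₁ := by
    have : (fun z : ℝ => P ^ z / l₁) = fun z => Real.exp (z * L ^ 9) / l₁ := funext fun z => by rw [hPz]
    rw [this]; fun_prop
  have hc₁cont : Continuous c₁ := by
    rw [hc₁def]
    refine Continuous.const_cpow ?_ (Or.inl hPC)
    fun_prop
  have hinner_cont : ContinuousOn innerF (Icc 0.5 0.504) := by
    have hVc := hVcont (P ^ (0.5 : ℝ) / l₁) (P ^ (0.504 : ℝ) / l₁) (hxpos 0.5)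
    have hmaps : MapsTo (fun z : ℝ => P ^ z / l₁) (Icc 0.5 0.504)
        (Icc (P ^ (0.5 : ℝ) / l₁) (P ^ (0.504 : ℝ) / l₁)) := by
      intro z hz
      exact ⟨div_le_div_of_nonneg_right (Real.rpow_le_rpow_of_exponent_le hP1 hz.1) hl₁0.le,
        div_le_div_of_nonneg_right (Real.rpow_le_rpow_of_exponent_le hP1 hz.2) hl₁0.le⟩
    have h1 : ContinuousOn (fun z : ℝ => V (P ^ z / l₁)) (Icc 0.5 0.504) :=
      hVc.comp hx₁cont.continuousOn hmaps
    rw [hinnerF]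
    exact (hc₁cont.continuousOn.mul h1).sub continuousOn_const
  have hinner_int : IntervalIntegrable innerF volume 0.5 0.504 := by
    have h : ContinuousOn innerF (uIcc 0.5 0.504) := by rwa [Set.uIcc_of_le hle]
    exact h.intervalIntegrable
  have hm_int : IntervalIntegrable (fun z : ℝ => βj / β * (c₁ z - c₂)) volume 0.5 0.504 :=
    (continuous_const.mul (hc₁cont.sub continuous_const)).intervalIntegrable _ _
  -- ### `doubleB15` and `valueB15` as `z`-integrals of `innerF` and of the main term
  have hdouble : doubleB15 c' D j l₁ = ((1 / 0.504 : ℝ) : ℂ) * ∫ z in (0.5 : ℝ)..0.504, innerF z := by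
    rw [doubleB15, hinnerF]
    congr 1
    refine intervalIntegral.integral_congr fun z _ => ?_
    exact hinner z
  have hvalue : valueB15 c' D j =
      ((1 / 0.504 : ℝ) : ℂ) * ∫ z in (0.5 : ℝ)..0.504, βj / β * (c₁ z - c₂) := by
    rw [hc₁def, intervalIntegral.integral_const_mul, valueB15, mul_assoc]
  -- ### assembly
  rw [hdouble, hvalue, ← mul_sub, ← intervalIntegral.integral_sub hinner_int hm_int, norm_mul]
  have hnorm_coef : ‖((1 / 0.504 : ℝ) : ℂ)‖ = 1 / 0.504 := by
    rw [Complex.norm_real, Real.norm_of_nonneg (by norm_num)]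
  have hint_bound : ‖∫ z in (0.5 : ℝ)..0.504, (innerF z - βj / β * (c₁ z - c₂))‖ ≤
      (2 * C₀ + 2 * C₁) * alpha D * |(0.504 : ℝ) - 0.5| := by
    refine intervalIntegral.norm_integral_le_of_norm_le_const fun z hz => ?_
    rw [Set.uIoc_of_le hle] at hz
    rw [hinnerF]
    exact hE z hz.1.le hz.2
  have habs : |(0.504 : ℝ) - 0.5| = 0.004 := by
    rw [abs_of_pos (by norm_num)]; norm_num
  rw [habs] at hint_bound
  rw [hnorm_coef]
  have hα1 : alpha D ≤ alpha1 D := by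
    have h := alpha_mul_ell_le_alpha1 hD3
    have h2 : alpha D ≤ alpha D * ell D :=
      le_mul_of_one_le_right hα0.le (by rw [← hLdef]; exact hL1)
    exact h2.trans h
  have hcoef : 0 ≤ (1 / 0.504) * ((2 * C₀ + 2 * C₁) * 0.004) := by positivity
  calc 1 / 0.504 * ‖∫ z in (0.5 : ℝ)..0.504, (innerF z - βj / β * (c₁ z - c₂))‖
      ≤ 1 / 0.504 * ((2 * C₀ + 2 * C₁) * alpha D * 0.004) := by gcongr
    _ = (1 / 0.504) * ((2 * C₀ + 2 * C₁) * 0.004) * alpha D := by ring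
    _ ≤ (1 / 0.504) * ((2 * C₀ + 2 * C₁) * 0.004) * alpha1 D :=
        mul_le_mul_of_nonneg_left hα1 hcoef

variable (c' : ℝ) in
/-- `StepB_u015bR` — `_holds` alias of `stepB_u015bR_holds` above under the fact's exact name, stated under the
prover's own binders as section variables (appended 2026-08-28, D-0026 bookkeeping: the proof term is the
existing theorem of this file; no statement, definition or attribute is edited; no new named fact; the
ledger's debt table listed the fact unproved). [cite: Zhang2022LandauSiegel, App. B p.108] -/
theorem _root_.Literature.NumberTheory.LFunctions.Zhang2022.Typed.AppendixB.StepB_u015bR_holds :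
    _root_.Literature.NumberTheory.LFunctions.Zhang2022.Typed.AppendixB.StepB_u015bR c' :=
  _root_.Literature.NumberTheory.LFunctions.Zhang2022.AppendixBVarrho.stepB_u015bR_holds (c' := c')

end Literature.NumberTheory.LFunctions.Zhang2022.AppendixBVarrho
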